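import Summits.QuantumFields.YangMills.Theorems.ParabolicTrajectoryLatticeGapOnTrajectoryStubGapOfDecay
import Summits.QuantumFields.YangMills.Theorems.ParabolicTrajectoryLatticeGapOnTrajectoryStubSlabClusteringOfDecay
import Summits.QuantumFields.YangMills.Theorems.ParabolicTrajectoryLatticeGapOnTrajectoryStubDecayOfTypicalWindows
import HarnessLib

/-!
# Crux `LatticeGapOnTrajectory` (stmt-QuantumFields-10523): Sub₁ from the ENGINE-INDEPENDENT decay interface
# (lead c4, line `sparse-defect-orbit-window` / SketchIdeator5-r2)

The two landed deployments re-plumbed through `CellDecayAlongP` (`stub_gapOfDecay` p127898 ← p95642;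
`stub_slabClusteringOfDecay` ← p123095), fed with the landed torus frames, window-averaging toolkit and DLR
description of Wilson's torus measure, make the pure-lattice sub-statement Sub₁ of the split
(`Split.LatticeGapOnTrajectoryLat`, p124272) a consequence of ONE typed interface:

* `latticeGapOnTrajectoryLat_of_cellDecay` — if along every tuned `M`-adic weak-coupling Wilson scheme of every
  compact simple `G` the decay package `CellDecayAlongP r M sch n` holds, then Sub₁ holds; hence the repaired crux
  `Split.LatticeGapOnTrajectoryRV` (`latticeGapOnTrajectoryRV_of_cellDecay`) and, given the two certified residuals
  of the FILED text, the filed crux (`latticeGapOnTrajectory_of_cellDecay`).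
* The interface is reached by the okfs line (`cellDecayAlongP_of_windowsP`, Defs p127447: `KREngine ∧
  OrbitKRWindowsAlongP`) and by this line (`stub_decayOfTypicalWindows`, p127716: annealed engine + typical package);
  `latticeGapOnTrajectoryLat_of_typical` records the latter composition: Sub₁ ⇐ `SparseDefectEngine` ∧ (crux hyps ⇒
  `TypicalOrbitWindowsAlongP`).

References: Dobrushin–Shlosman 1985; Föllmer 1988 Ch. I §2; Osterwalder–Seiler 1978 §2; Glimm–Jaffe 1987 §19.7.
-/

set_option autoImplicit false

noncomputable section

namespace Summit.QuantumFields.YangMills.Cruxes.LatticeGapOnTrajectory.SparseDefectOrbitWindow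

open scoped Topology
open Filter MeasureTheory
open Literature.MathematicalPhysics.QuantumFieldTheory
open Summit.QuantumFields.YangMills.Theses.ParabolicTrajectory
open Summit.QuantumFields.YangMills.Cruxes.LatticeGapOnTrajectory.OrbitKantorovichFiniteSize

/-- **Sub₁ ⇐ the decay interface** (`latticeGapOnTrajectoryLat_of_cellDecay`): if the decay package
`CellDecayAlongP` holds along every tuned `M`-adic weak-coupling Wilson scheme of every compact simple `G`, then
`Split.LatticeGapOnTrajectoryLat` holds — the per-pair lattice gap from `stub_gapOfDecay` at some `Δ₁ > 0`, uniform
slab clustering from `stub_slabClusteringOfDecay` at some `Δ₂ > 0`, glued at `min Δ₁ Δ₂` (both antitone).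
[cite: Follmer1988, Ch. I Theorem (2.13)] [cite: GlimmJaffe1987, §19.7] -/
theorem latticeGapOnTrajectoryLat_of_cellDecay
    (hD : ∀ (G : Type) [Group G] [TopologicalSpace G] [IsTopologicalGroup G] [CompactSpace G]
      [MeasurableSpace G] [BorelSpace G], IsCompactSimpleLieGroup G →
      ∀ (r : LatticeRep G) (M : ℕ) (θ : ℝ) (sch : SpeciesScheme (YMSpecies G)) (n : ℕ → ℕ),
        2 ≤ M → 0 < θ → (∀ k, sch.a k = ((M : ℝ) ^ n k)⁻¹) → Tendsto sch.β atTop atTop →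
        Tendsto (fun k => ((M : ℝ) ^ n k) ^ 8 *
            latticeConnectedCorr r.ρ (sch.β k) (sch.side k) r.curvature.F r.curvature.F (M ^ n k))
          atTop (𝓝 θ) → CellDecayAlongP r M sch n) :
    Split.LatticeGapOnTrajectoryLat := by
  intro G _ _ _ _ _ _ hG r M θ sch n hM hθ hshape hβ htune
  have hDk := hD G hG r M θ sch n hM hθ hshape hβ htune
  obtain ⟨Δ₁, hΔ₁, hlat⟩ :=
    stub_gapOfDecay G r M sch n hM hshape stub_torusFrames stub_specificationTower (stub_wilsonTorusDLR G r) hDk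
  obtain ⟨Δ₂, hΔ₂, hclust⟩ :=
    stub_slabClusteringOfDecay G r M sch n hM hshape stub_torusFrames stub_specificationTower
      (stub_wilsonTorusDLR G r) hDk
  exact ⟨min Δ₁ Δ₂, lt_min hΔ₁ hΔ₂, Split.hasLatticeMassGap_of_le r sch (min_le_left _ _) hlat,
    Split.uniformSlabClustering_of_le r sch (min_le_right _ _) hclust⟩

/-- **The repaired crux ⇐ the decay interface**: `Split.LatticeGapOnTrajectoryRV` (filed text + volume clause,
transfer restricted to reflection-symmetric polynomially bounded witnesses) follows from the decay package along
every tuned scheme, through Sub₁ and the landed symmetric transfer. [cite: GlimmJaffe1987, §19.7] -/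
theorem latticeGapOnTrajectoryRV_of_cellDecay
    (hD : ∀ (G : Type) [Group G] [TopologicalSpace G] [IsTopologicalGroup G] [CompactSpace G]
      [MeasurableSpace G] [BorelSpace G], IsCompactSimpleLieGroup G →
      ∀ (r : LatticeRep G) (M : ℕ) (θ : ℝ) (sch : SpeciesScheme (YMSpecies G)) (n : ℕ → ℕ),
        2 ≤ M → 0 < θ → (∀ k, sch.a k = ((M : ℝ) ^ n k)⁻¹) → Tendsto sch.β atTop atTop →
        Tendsto (fun k => ((M : ℝ) ^ n k) ^ 8 *
            latticeConnectedCorr r.ρ (sch.β k) (sch.side k) r.curvature.F r.curvature.F (M ^ n k))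
          atTop (𝓝 θ) → CellDecayAlongP r M sch n) :
    Split.LatticeGapOnTrajectoryRV :=
  Split.latticeGapOnTrajectoryRV_of_lat (latticeGapOnTrajectoryLat_of_cellDecay hD)

/-- **The filed crux ⇐ the decay interface and the two certified residuals**: Sub₁ from the decay package,
Sub₂ (volume clause) and Sub₃ (symmetrisation of the transfer clause) as hypotheses, glued by the landed
`Split.latticeGapOnTrajectory_of_subs` (p124272). [cite: OsterwalderSeiler1978, §2] -/
theorem latticeGapOnTrajectory_of_cellDecay
    (hD : ∀ (G : Type) [Group G] [TopologicalSpace G] [IsTopologicalGroup G] [CompactSpace G]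
      [MeasurableSpace G] [BorelSpace G], IsCompactSimpleLieGroup G →
      ∀ (r : LatticeRep G) (M : ℕ) (θ : ℝ) (sch : SpeciesScheme (YMSpecies G)) (n : ℕ → ℕ),
        2 ≤ M → 0 < θ → (∀ k, sch.a k = ((M : ℝ) ^ n k)⁻¹) → Tendsto sch.β atTop atTop →
        Tendsto (fun k => ((M : ℝ) ^ n k) ^ 8 *
            latticeConnectedCorr r.ρ (sch.β k) (sch.side k) r.curvature.F r.curvature.F (M ^ n k))
          atTop (𝓝 θ) → CellDecayAlongP r M sch n)
    (h₂ : Split.VolumeGrowthOnTrajectory) (h₃ : Split.SymmetrisationOnTrajectory) : LatticeGapOnTrajectory :=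
  Split.latticeGapOnTrajectory_of_subs (latticeGapOnTrajectoryLat_of_cellDecay hD) h₂ h₃

/-- **Sub₁ ⇐ this line's two open stubs** (`latticeGapOnTrajectoryLat_of_typical`): the annealed sparse-defect
engine together with the typical orbit–Kantorovich package along every tuned scheme (the statements of the
registered stubs `stub_sparseDefectEngine` and `stub_typicalOrbitWindow`) give Sub₁, through the landed plumbing
`stub_decayOfTypicalWindows` (p127716) and the decay interface. Under the restatement the line is therefore closed
modulo exactly these two stubs. [cite: DobrushinShlosman1985, Theorem] -/
theorem latticeGapOnTrajectoryLat_of_typical (hE : SparseDefectEngine)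
    (hT : ∀ (G : Type) [Group G] [TopologicalSpace G] [IsTopologicalGroup G] [CompactSpace G]
      [MeasurableSpace G] [BorelSpace G], IsCompactSimpleLieGroup G →
      ∀ (r : LatticeRep G) (M : ℕ) (θ : ℝ) (sch : SpeciesScheme (YMSpecies G)) (n : ℕ → ℕ),
        2 ≤ M → 0 < θ → (∀ k, sch.a k = ((M : ℝ) ^ n k)⁻¹) → Tendsto sch.β atTop atTop →
        Tendsto (fun k => ((M : ℝ) ^ n k) ^ 8 *
            latticeConnectedCorr r.ρ (sch.β k) (sch.side k) r.curvature.F r.curvature.F (M ^ n k))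
          atTop (𝓝 θ) → TypicalOrbitWindowsAlongP r M sch n) :
    Split.LatticeGapOnTrajectoryLat :=
  latticeGapOnTrajectoryLat_of_cellDecay fun G _ _ _ _ _ _ hG r M θ sch n hM hθ hshape hβ htune =>
    stub_decayOfTypicalWindows G r M sch n hE (stub_wilsonTorusDLR G r)
      (hT G hG r M θ sch n hM hθ hshape hβ htune)

end Summit.QuantumFields.YangMills.Cruxes.LatticeGapOnTrajectory.SparseDefectOrbitWindow

end
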